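import Mathlib
import Summits.Ventures.HodgeRepro2.T5PrincipalUnitFiltration
import Summits.Ventures.HodgeRepro2.T5PrincipalUnitComparison

/-!
# Characters of every exact conductor trivial on the base units
(kernel witness for the standard fact (A10) of the Tier-5 [A]-ledger at the level of unit groups:
«at an inert `v`, conjugate-orthogonal characters of every exact conductor `a ≥ 1` exist»)

With `T5PrincipalUnitFiltration` (`U_n/U_{n+1} ≅ k`, `Rˣ/U_1 ≅ k^×`) and
`T5PrincipalUnitComparison` (`U_{S,n} ⊄ U_{S,n+1} · (image of Rˣ)` when the residue map is not
surjective) the existence statement is a matter of finite abelian group theory: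

* `exists_monoidHom_trivial_on_ne_one` — for `H ≤ Γ` of finite index and `x ∉ H` there is a
  character `Γ →* ℂˣ` trivial on `H` and non-trivial at `x` (characters of the finite abelian
  group `Γ/H` separate points);
* `finiteIndex_higherUnits` — over a discrete valuation ring with finite residue field every `U_n`
  has finite index in `Rˣ`;
* `exists_units_not_mem_sup_one` — the case `a = 1`: some unit of `S` lies outside
  `U_{S,1} · (image of Rˣ)`;
* `exists_character_exact_level` — **for every `n` there is `χ : Sˣ →* ℂˣ` trivial on `U_{S,n+1}`
  and on the image of `Rˣ`, non-trivial on `U_{S,n}`**: a character of `𝒪_{E_v}^×` trivial on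
  `𝒪_{F_v}^×` of exact conductor `n + 1`.

Stays prose: the inflation to `E_v^×/F_v^× ≅ 𝒪_E^×/𝒪_F^×` (second isomorphism theorem and
`E_v^× = 𝒪_E^× · π_F^ℤ` at an inert place), and the local-field facts behind the hypotheses
(common uniformiser, finite residue field, residue degree `2`).
Imports: Mathlib + two accepted files of this prefix; axioms standard.
Uses an L-value-free non-vanishing device: NO (README §8(d)).
-/
namespace Summit.Ventures.HodgeRepro2.T5ConductorExistence

open Summit.Ventures.HodgeRepro2.T5PrincipalUnitFiltration
open Summit.Ventures.HodgeRepro2.T5PrincipalUnitComparison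

/-! ### A. Characters of a finite-index quotient separate points -/

section Separation

variable {Γ : Type*} [CommGroup Γ]

/-- For a subgroup `H` of finite index of a commutative group `Γ` and `x ∉ H`, there is a
character `χ : Γ →* ℂˣ` trivial on `H` with `χ x ≠ 1` (characters of the finite abelian group
`Γ/H` separate points: Mathlib's `CommGroup.exists_apply_ne_one_of_hasEnoughRootsOfUnity`). -/
theorem exists_monoidHom_trivial_on_ne_one (H : Subgroup Γ) [H.FiniteIndex] {x : Γ}
    (hx : x ∉ H) : ∃ χ : Γ →* ℂˣ, (∀ h ∈ H, χ h = 1) ∧ χ x ≠ 1 := by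
  haveI : Finite (Γ ⧸ H) := H.finite_quotient_of_finiteIndex
  haveI : NeZero (Monoid.exponent (Γ ⧸ H)) := ⟨Monoid.exponent_ne_zero_of_finite⟩
  have hx' : (QuotientGroup.mk x : Γ ⧸ H) ≠ 1 := by
    rwa [ne_eq, QuotientGroup.eq_one_iff]
  obtain ⟨φ, hφ⟩ := CommGroup.exists_apply_ne_one_of_hasEnoughRootsOfUnity (Γ ⧸ H) ℂ hx'
  refine ⟨φ.comp (QuotientGroup.mk' H), fun h hh => ?_, hφ⟩
  have h1 : (QuotientGroup.mk h : Γ ⧸ H) = 1 := (QuotientGroup.eq_one_iff h).mpr hh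
  simp [h1]

end Separation

/-! ### B. Finite index of the higher unit groups (finite residue field) -/

section FiniteIndex

variable {R : Type*} [CommRing R] [IsDomain R] [IsDiscreteValuationRing R] (ϖ : R)

/-- Over a discrete valuation ring with FINITE residue field, every `U_n` has finite index in
`Rˣ` (`|Rˣ/U_1| = |k^×|`, `|U_n/U_{n+1}| = |k|`, and indices multiply). -/
theorem finiteIndex_higherUnits (hϖ : Irreducible ϖ) [Finite (IsLocalRing.ResidueField R)]
    (n : ℕ) : (higherUnits ϖ n).FiniteIndex := by
  induction n with
  | zero =>
    rw [higherUnits_zero]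
    infer_instance
  | succ n ih =>
    rw [Subgroup.finiteIndex_iff]
    rcases Nat.eq_zero_or_pos n with rfl | hn
    · -- `Rˣ / U_1 ≃ k^×`
      rw [Subgroup.index_eq_card, Nat.card_congr (unitsQuotEquivResidueFieldUnits ϖ hϖ).toEquiv]
      exact Nat.card_ne_zero.mpr ⟨inferInstance, inferInstance⟩
    · rw [← Subgroup.relIndex_mul_index (higherUnits_succ_le ϖ n)]
      refine mul_ne_zero ?_ ih.index_ne_zero
      rw [Subgroup.relIndex, Subgroup.index_eq_card,
        card_higherUnits_quot_eq_card_residueField ϖ n hϖ hn]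
      exact Nat.card_ne_zero.mpr ⟨inferInstance, inferInstance⟩

end FiniteIndex

/-! ### C. The case `a = 1`: `Rˣ ⊄ U_1 · (image of the base units)` -/

section LevelOne

variable {R S : Type*} [CommRing R] [CommRing S] [Algebra R S] [IsLocalRing S] (ϖ : R)

/-- If the residue map `R/(ϖ) → S/(ϖ_S)` is not surjective and `(ϖ_S) = 𝔪_S`, some unit of `S` is
not in `U_{S,1} · (image of Rˣ)`. -/
theorem exists_units_not_mem_sup_one (hϖ : Ideal.span {algebraMap R S ϖ} = IsLocalRing.maximalIdeal S)
    (hne : ¬ Function.Surjective (residueMap (S := S) ϖ)) :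
    ∃ u : Sˣ, u ∉ higherUnits (algebraMap R S ϖ) 1 ⊔ (unitsMap (R := R) (S := S)).range := by
  rw [Function.Surjective, not_forall] at hne
  obtain ⟨y, hy⟩ := hne
  obtain ⟨s, rfl⟩ := Ideal.Quotient.mk_surjective y
  -- `s` is a unit: `mk s ≠ 0`, so `s ∉ 𝔪_S`
  have hs0 : Ideal.Quotient.mk (Ideal.span {algebraMap R S ϖ}) s ≠ 0 := by
    intro h0
    exact hy ⟨0, by rw [map_zero, h0]⟩
  have hsu : IsUnit s := by
    by_contra hsu
    apply hs0
    rw [Ideal.Quotient.eq_zero_iff_mem, hϖ]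
    exact (IsLocalRing.mem_maximalIdeal s).mpr hsu
  refine ⟨hsu.unit, fun hmem => ?_⟩
  rw [Subgroup.mem_sup] at hmem
  obtain ⟨v, hv, w, ⟨r, hr⟩, hvw⟩ := hmem
  apply hy
  refine ⟨Ideal.Quotient.mk _ (r : R), ?_⟩
  have hv1 : Ideal.Quotient.mk (Ideal.span {algebraMap R S ϖ}) (v : S) = 1 := by
    rw [mem_higherUnits, pow_one] at hv
    rw [← sub_eq_zero, ← map_one (Ideal.Quotient.mk _), ← map_sub, Ideal.Quotient.eq_zero_iff_mem,
      Ideal.mem_span_singleton]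
    exact hv
  have hw : (w : S) = algebraMap R S (r : R) := by
    rw [← hr]
    rfl
  have hs : s = (v : S) * (w : S) := by
    rw [← Units.val_mul, hvw]
    exact hsu.unit_spec.symm
  rw [residueMap_mk, hs, map_mul, hv1, one_mul, hw]

end LevelOne

/-! ### D. Assembly: characters of every exact level trivial on the base units -/

section Assembly

variable {R S : Type*} [CommRing R] [CommRing S] [Algebra R S] [IsDomain R] [IsDomain S]
  [IsDiscreteValuationRing R] [IsDiscreteValuationRing S] (ϖ : R)

/-- **(A10) at the level of unit groups.** `R → S` an injective map of discrete valuation rings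
with a common uniformiser `ϖ`, `S` with finite residue field, residue map `R/(ϖ) → S/(ϖ)` not
surjective (residue degree `> 1`).  Then for every `n` there is a character `χ : Sˣ →* ℂˣ`
trivial on `U_{S,n+1}` and on the image of `Rˣ`, and non-trivial on `U_{S,n}` — a character of
`𝒪_E^×` trivial on `𝒪_F^×` of exact conductor `n + 1`. -/
theorem exists_character_exact_level (hinj : Function.Injective (algebraMap R S))
    (hϖ : Irreducible ϖ) (hϖS : Irreducible (algebraMap R S ϖ))
    [Finite (IsLocalRing.ResidueField S)]
    (hne : ¬ Function.Surjective (residueMap (S := S) ϖ)) (n : ℕ) :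
    ∃ χ : Sˣ →* ℂˣ, (∀ u ∈ higherUnits (algebraMap R S ϖ) (n + 1), χ u = 1) ∧
      (∀ r : Rˣ, χ (unitsMap r) = 1) ∧ ∃ u ∈ higherUnits (algebraMap R S ϖ) n, χ u ≠ 1 := by
  -- the subgroup `K = U_{n+1} ⊔ image`, of finite index
  haveI : (higherUnits (algebraMap R S ϖ) (n + 1)).FiniteIndex :=
    finiteIndex_higherUnits _ hϖS (n + 1)
  haveI : (higherUnits (algebraMap R S ϖ) (n + 1) ⊔
      (unitsMap (R := R) (S := S)).range).FiniteIndex :=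
    Subgroup.finiteIndex_of_le le_sup_left
  -- an element of `U_n` outside `K`
  obtain ⟨u, hu, hnot⟩ : ∃ u ∈ higherUnits (algebraMap R S ϖ) n,
      u ∉ higherUnits (algebraMap R S ϖ) (n + 1) ⊔ (unitsMap (R := R) (S := S)).range := by
    rcases Nat.eq_zero_or_pos n with rfl | hn
    · obtain ⟨u, hu⟩ := exists_units_not_mem_sup_one ϖ hϖS.maximalIdeal_eq.symm hne
      exact ⟨u, by simp [higherUnits_zero], hu⟩
    · exact exists_mem_higherUnits_not_mem_sup_of_dvr ϖ hinj hϖ hϖS n hn hne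
  obtain ⟨χ, hχK, hχu⟩ := exists_monoidHom_trivial_on_ne_one _ hnot
  refine ⟨χ, fun v hv => hχK v (Subgroup.mem_sup_left hv), fun r => hχK _ (Subgroup.mem_sup_right ⟨r, rfl⟩),
    u, hu, hχu⟩

end Assembly

end Summit.Ventures.HodgeRepro2.T5ConductorExistence
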